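import Summits.Ventures.HodgeKum4.Theorems.KummerFixedLocusDominatedSpan
import Summits.Ventures.HodgeKum4.Theorems.KummerFixedLocusDegreewiseAlgebraic
import Literature.AlgebraicGeometry.Hyperkaehler.KummerTypeIntermediateJacobian
import Literature.AlgebraicGeometry.Hyperkaehler.GeneralizedKummerTypeLefschetzStandard
import Literature.AlgebraicGeometry.HodgeTheory.WeilFourfoldsDiscOnePowers
import Literature.AlgebraicGeometry.HodgeTheory.HardLefschetzNFoldHolds
import Literature.AlgebraicGeometry.HodgeTheory.CanonicalTrace
import Literature.AlgebraicGeometry.HodgeTheory.DominatedByPowersHodgeConjecture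
import Literature.AlgebraicGeometry.HodgeTheory.PowSuccProductCone
import Literature.AlgebraicGeometry.Motives.AbelianVarietyProjectiveChart
import HarnessLib

/-!
# L2a′ `GammaInvariantsDominatedKum4` from four printed facts and L1 (cell `hodge-kum4`, seat p2)

HONEST FRAMING.  CONDITIONAL theorem: the span-form node L2a′ of route `KummerFixedLocus`
(`Summits/Ventures/HodgeKum4/Statement.lean` §6: given L1, the `Γ(X)`-invariant classes of a smooth
projective `Kum⁴`-type `X` are dominated by the powers of an abelian fourfold all of whose powers
satisfy the Hodge conjecture) is PROVED from four NAMED PRINTED FACTS of the tree taken as hypotheses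
— the theorem is conditional on them and on nothing else (no `sorry`, standard axioms):

* `Hyperkaehler.OGradyVoisin2022_thirdJacobian_kugaSatake_kummerType` (O'Grady 2021 Thm. 1.5,
  Markman 2023 Thm. 1.4, Voisin 2022 Thm. 4.1: `T = J³(X)` a disc-1 Weil fourfold, `γ : H¹(T) ≅ H³(X)`
  and `S : H⁶(T) ↠ H¹⁴(X)` algebraic correspondences);
* `HodgeTheory.FloccariFu2026_hodgeClasses_algebraic_powers_discOneWeilFourfold` (HC for all powers
  of disc-1 Weil fourfolds; via `hodgeConjectureFor_powSucc_of_floccariFu`);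
* `Hyperkaehler.Foster2024_lefschetzStandard_kummerType_prime` (`B(X)`: `*_L` algebraic, `n + 1 = 5`);
* `HodgeTheory.Andre1996_dualLefschetz_mem_adjoin_lefschetzInvolution` — the GUARDED dual-Lefschetz
  fact (`0 < d`, `IsSmoothProjective d X`, hard Lefschetz): `ᶜΛ ∈ adjoin{L_η, *_L}`.

Proof: at the hyperplane polarisation `η` (`nonempty_hardLefschetzNFold_holds`, a theorem of the tree)
André gives `Λ` with `(L_η, h, Λ)` an `sl₂`-triple and `Λ ∈ adjoin{L_η, *_L}`; by Foster every degree
component of `*_L` is algebraic, so `Λ` is degreewise `0`-or-algebraic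
(`zero_or_isAlgebraicCorrespondence_of_mem_adjoin`); L1 at `(η, Λ)` puts the invariants in
`opCupSpan Λ (degreeClasses {0,2,3})`, which is dominated by the powers of `T` once `H⁰, H², H³` are
(`opCupSpan_le_totalDominated`): `H⁰ = ℂ·1 = t^* H⁰(T⁰)`, `H³ = γ(H¹ T)`, `H² = *_L S(H⁶ T)`.
-/

noncomputable section

open CategoryTheory MonoidalCategory CartesianMonoidalCategory DirectSum
open Literature.AlgebraicGeometry Literature.AlgebraicGeometry.Motives Literature.AlgebraicGeometry.HodgeTheory
open Literature.AlgebraicGeometry.Hyperkaehler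
open Literature.AlgebraicTopology.SingularHomology Literature.Geometry.Kaehler
open Summit.HodgeConjecture.HodgeConjecture.Ring2.AbelianAll (IsAlgebraicCorrespondence.comp)

namespace Summit.Ventures.HodgeKum4

/-! ### Powers of an abelian variety: `(T^{(m+1)}).X ≅ T.X^{m+1}` and the Hodge conjecture -/

/-- `(T.powSucc m).X ≅ T.X.pow (m + 1)` (both are iterated binary products; base case the left
unitor). -/
theorem nonempty_powSuccIso (T : AbelianVariety ℂ) :
    ∀ m : ℕ, Nonempty ((T.powSucc m).X ≅ T.X.pow (m + 1))
  | 0 => ⟨(powOneIso T.X).symm⟩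
  | m + 1 => (nonempty_powSuccIso T m).elim fun i => ⟨whiskerRightIso i T.X⟩

/-- HC for every `T.powSucc m` (in its dimension) gives HC for every cartesian power `T.X.pow (m + 1)`
in dimension `(m + 1) · dim T`, the shape of `GammaInvariantsDominatedKum4`. -/
theorem hodgeConjectureFor_pow_of_powSucc (T : AbelianVariety ℂ) (hT : T.dim = 2 * 2)
    (h : ∀ k : ℕ, HodgeConjectureFor (T.powSucc k).dim (T.powSucc k).X) (m : ℕ) :
    HodgeConjectureFor ((m + 1) * 4) (T.X.pow (m + 1)) := by
  obtain ⟨i⟩ := nonempty_powSuccIso T m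
  have hd : (T.powSucc m).dim = (m + 1) * 4 := by
    rw [dim_powSucc', hT]
  rw [← hd]
  exact (hodgeConjectureFor_iff_of_iso' i).1 (h m)

/-! ### Seeds: `H⁰`, `H³`, `H²` are dominated by the powers of `T = J³(X)` -/

section Seeds

variable {X B : SchemeOver ℂ} {dX : ℕ}

/-- `H⁰(X(ℂ)) = ℂ · 1` is dominated (by `B⁰ = Spec ℂ`, through `t^*`, `t : X → Spec ℂ`). -/
theorem degreeZero_mem_dominatedClasses (hX : IsSmoothProjective 8 X) (hB : IsSmoothProjective dX B)
    (c : complexBetti X 0) : c ∈ dominatedClasses 8 X dX B 0 := by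
  obtain ⟨r, rfl⟩ := exists_eq_smul_one_of_isSmoothProjective hX ℂ c
  have h0 : IsSmoothProjective (0 * dX) (B.pow 0) := hB.pow 0
  let t : X ⟶ B.pow 0 := toUnit X
  have hT : IsAlgebraicCorrespondence 8 (0 * dX) X (B.pow 0) (complexBetti.map t 0).hom :=
    isAlgebraicCorrespondence_map hX h0 t (Nat.zero_le _)
  have h1 : (complexBetti.map t 0).hom (singularCohomology.one ℂ (Motives.ComplexPoints (B.pow 0))) =
      singularCohomology.one ℂ (Motives.ComplexPoints X) :=
    singularCohomology.map_one (Motives.AlgPoints.mapContinuous (L := ℂ) t)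
  have := mem_dominatedClasses_of_apply hT (r • singularCohomology.one ℂ (Motives.ComplexPoints (B.pow 0)))
  rwa [map_smul, h1] at this

/-- Pulling back along `(λ_B)⁻¹ : B → B¹ = Spec ℂ ⊗ B` and then back along `λ_B` is the identity. -/
theorem map_powOneIso_inv_map_hom (B : SchemeOver ℂ) {i : ℕ} (x : complexBetti B i) :
    complexBetti.map (powOneIso B).inv i (complexBetti.map (powOneIso B).hom i x) = x := by
  rw [← complexBetti.map_comp_apply', Iso.inv_hom_id, complexBetti.map_id]
  rfl

/-- `H³(X(ℂ)) = γ(H¹(T))` is dominated by `T¹`, for `γ` a surjective algebraic correspondence from the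
fourfold `B = T`. -/
theorem degreeThree_mem_dominatedClasses (hX : IsSmoothProjective 8 X) (hB : IsSmoothProjective 4 B)
    {γ : complexBetti B 1 →ₗ[ℂ] complexBetti X 3} (hγ : Function.Surjective γ)
    (hγalg : IsAlgebraicCorrespondence 8 4 X B γ) (c : complexBetti X 3) :
    c ∈ dominatedClasses 8 X 4 B 3 := by
  have h1 : IsSmoothProjective (1 * 4) (B.pow 1) := hB.pow 1
  have hι : IsAlgebraicCorrespondence 4 (1 * 4) B (B.pow 1) (complexBetti.map (powOneIso B).inv 1).hom :=
    isAlgebraicCorrespondence_map hB h1 (powOneIso B).inv (by omega)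
  have hT : IsAlgebraicCorrespondence 8 (1 * 4) X (B.pow 1) (γ ∘ₗ (complexBetti.map (powOneIso B).inv 1).hom) :=
    IsAlgebraicCorrespondence.comp hX hB h1 hι hγalg (by omega)
  obtain ⟨x, rfl⟩ := hγ c
  have := mem_dominatedClasses_of_apply hT (complexBetti.map (powOneIso B).hom 1 x)
  rwa [LinearMap.comp_apply, show (complexBetti.map (powOneIso B).inv 1).hom
    (complexBetti.map (powOneIso B).hom 1 x) = x from map_powOneIso_inv_map_hom B x] at this

/-- `H²(X(ℂ)) = *_L S(H⁶(T))` is dominated by `T¹`, for `S : H⁶(T) ↠ H¹⁴(X)` a surjective algebraic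
correspondence and `*_L : H¹⁴ → H²` the (bijective) Lefschetz involution, algebraic by `B(X)`. -/
theorem degreeTwo_mem_dominatedClasses (hX : IsSmoothProjective 8 X) (hB : IsSmoothProjective 4 B)
    {S : complexBetti B 6 →ₗ[ℂ] complexBetti X 14} (hS : Function.Surjective S)
    (hSalg : IsAlgebraicCorrespondence 8 4 X B S) {η : complexBetti X 2} (hL : HasHardLefschetzProperty η 8)
    (hstar : IsAlgebraicCorrespondence 8 8 X X (lefschetzInvolution hL (show 14 + 2 = 2 * 8 by norm_num)))
    (c : complexBetti X 2) : c ∈ dominatedClasses 8 X 4 B 2 := by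
  have h1 : IsSmoothProjective (1 * 4) (B.pow 1) := hB.pow 1
  have hι : IsAlgebraicCorrespondence 4 (1 * 4) B (B.pow 1) (complexBetti.map (powOneIso B).inv 6).hom :=
    isAlgebraicCorrespondence_map hB h1 (powOneIso B).inv (by omega)
  have hT₁ : IsAlgebraicCorrespondence 8 (1 * 4) X (B.pow 1) (S ∘ₗ (complexBetti.map (powOneIso B).inv 6).hom) :=
    IsAlgebraicCorrespondence.comp hX hB h1 hι hSalg (by omega)
  have hT : IsAlgebraicCorrespondence 8 (1 * 4) X (B.pow 1)
      (lefschetzInvolution hL (show 14 + 2 = 2 * 8 by norm_num) ∘ₗ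
        (S ∘ₗ (complexBetti.map (powOneIso B).inv 6).hom)) :=
    IsAlgebraicCorrespondence.comp hX hX h1 hT₁ hstar (by omega)
  obtain ⟨y, rfl⟩ := (lefschetzInvolution_bijective hL (show 14 + 2 = 2 * 8 by norm_num)).2 c
  obtain ⟨z, rfl⟩ := hS y
  have := mem_dominatedClasses_of_apply hT (complexBetti.map (powOneIso B).hom 6 z)
  rwa [LinearMap.comp_apply, LinearMap.comp_apply, show (complexBetti.map (powOneIso B).inv 6).hom
    (complexBetti.map (powOneIso B).hom 6 z) = z from map_powOneIso_inv_map_hom B z] at this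

end Seeds

/-! ### L2a′ -/

/-- **L2a′ `GammaInvariantsDominatedKum4`, CONDITIONAL on four printed facts** (O'Grady–Markman–Voisin,
Floccari–Fu, Foster, André — all REFEREED, all named facts of the tree, unproved there): given L1, the
`Γ(X)`-invariant classes of every smooth projective `Kum⁴`-type `X` are dominated by the powers of the
abelian fourfold `T = J³(X)`, all of whose powers satisfy the Hodge conjecture. -/
theorem gammaInvariantsDominatedKum4_of_facts
    (hOGV : OGradyVoisin2022_thirdJacobian_kugaSatake_kummerType)
    (hFF : FloccariFu2026_hodgeClasses_algebraic_powers_discOneWeilFourfold)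
    (hFo : Foster2024_lefschetzStandard_kummerType_prime)
    (hAn : Andre1996_dualLefschetz_mem_adjoin_lefschetzInvolution) :
    Summit.Ventures.HodgeKum4.GammaInvariantsDominatedKum4 := by
  intro hL1 X hX hK
  obtain ⟨d, T, φ, e, a, γ, S, hd, hTdim, hφ, ha, ha0, hyp, hγbij, hγalg, hSsurj, hSalg⟩ :=
    hOGV 4 (by norm_num) hX hK
  have hB : IsSmoothProjective 4 T.X := by
    have h := Motives.AbelianVariety.isSmoothProjective_holds (A := T)
    rw [Motives.AbelianVariety.isSmoothProjective, hTdim] at h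
    exact h
  refine ⟨T.X, hB, hodgeConjectureFor_pow_of_powSucc T hTdim
    (hodgeConjectureFor_powSucc_of_floccariFu hFF hd T φ hTdim hφ e a ha ha0 hyp), fun k c hc => ?_⟩
  -- the hyperplane polarisation and André's `Λ`
  obtain ⟨H⟩ := nonempty_hardLefschetzNFold_holds 8 X hX
  have hpol : IsPolarizationClass 8 X H.hyperplaneClass :=
    ⟨H.isRationalClass_hyperplaneClass, H.hyperplaneClass_mem, H.hasHardLefschetz⟩
  obtain ⟨Λ, hΛ, hΛadj⟩ := hAn 8 (by norm_num) hX H.hyperplaneClass hpol.hasHardLefschetz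
  -- Foster: the degree components of `*_L` are algebraic
  have hstar : ∀ (a b : ℕ) (hab : a + b = 2 * 8),
      IsAlgebraicCorrespondence 8 8 X X (lefschetzInvolution hpol.hasHardLefschetz hab) :=
    fun a b hab => hFo 4 (by norm_num) hX hK H.hyperplaneClass hpol a b hab
  -- L1 at `(η, Λ)` and the dominated span
  have hspan := hL1 hX hK H.hyperplaneClass Λ hΛ (ofDegree_mem_gammaInvariantClasses hc)
  have hdom := opCupSpan_le_totalDominated hX hB
    (zero_or_isAlgebraicCorrespondence_of_mem_adjoin hX hpol.mem_algebraicClasses hpol.hasHardLefschetz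
      hstar hΛadj)
    (degreeZero_mem_dominatedClasses hX hB)
    (degreeTwo_mem_dominatedClasses hX hB hSsurj hSalg hpol.hasHardLefschetz (hstar 14 2 (by norm_num)))
    (degreeThree_mem_dominatedClasses hX hB hγbij.2 hγalg) hspan
  exact (ofDegree_mem_totalDominated_iff c).1 hdom

end Summit.Ventures.HodgeKum4

end
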